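import Mathlib
import Literature.AlgebraicGeometry.Resolution.AugmentationIdeal
import Summits.ResolutionOfSingularities.ResolutionOfSingularities.Theorems.WildQuotientsWildQuotientResolutionInvolutionKLTwice

/-!
# Involutions with `2` invertible: the Rees parity lemma (card `mu2-strata-kl-twice`, H3)

(crux stmt-ResolutionOfSingularities-15640 `WildQuotients.WildQuotientResolution`, line `Sketch`,
sector `|G| = p`; RUNG V5 of `L/w45c/CHAIN.md` v8.2, brick B7/`HP₂` (the `μ₂`-HIGH exit of `J₅`),
route = res-L1-w45c-idea-2's card `mu2-strata-kl-twice`; CHAIN v8.2 §0 «HP₂ = 036 card-H K–L-twice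
((γ) p528222), H2/H3 stub-3 next»; statement = the def-free form of `Sketch-L1-idea-2.lean` v7
§Card H `InvolutionReesParity` (H3), with the simplification `K = I_ι²`. [OURS · L1 W4.5c] — NOT a
statement of any manuscript; replaces the role of no printed item. Prover res-L1-w45c-stub-3.)

Setting: `R` a commutative ring, `ι : R ≃+* R` an involution (`ι (ι x) = x`), `2 ∈ Rˣ`;
`I_ι := augIdeal ι` (Literature, = `(ι b − b : b)` = `(R₋)` by res-type-036's H1
`InvolutionExit.augIdeal_eq_span_anti`), `R₋ := {y | ι y = −y}`,
`K := (a·b : a, b ∈ R₋)` (the Sketch's ideal).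

* `span_anti_mul_anti_eq_sq` — **`K = I_ι²`** (`Ideal.span_mul_span'`).
* `add_apply_mem_pow_and_sub_apply_mem_pow` — THE PARITY ENGINE: for `z ∈ I_ι ^ n`,
  `z + ι z ∈ I_ι ^ (2⌈n/2⌉)` and `z − ι z ∈ I_ι ^ (2⌊n/2⌋ + 1)` (induction along
  `Submodule.pow_induction_on_right'`; step `x·m ± ι(x·m) = ½[(x + ιx)(m ± ιm) + (x − ιx)(m ∓ ιm)]`
  with `m + ι m ∈ I_ι²` = 036's `apply_add_self_mem_sq`).
* `mem_pow_iff_mem_pow_two_mul_of_invariant` — an INVARIANT `x` lies in `I_ι ^ n` iff it lies in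
  `I_ι ^ (2⌈n/2⌉)`; `mem_augIdeal_pow_iff_mem_span_pow_of_invariant` — the Sketch's H3 VERBATIM:
  `x ∈ I_ι ^ n ↔ x ∈ K ^ ((n + 1) / 2)` for `ι x = x`.
Consequence (used by HP₂, not restated here): `(Rees_{I_ι} R)^ι = ⊕ₙ (K ∩ R₊)^{⌈n/2⌉}`, so
`(Bl_{I_ι} W′)/ι = Bl_{K ∩ R₊}(W′/ι)` — the reduced image of `Fix ι` when `R/I_ι` is regular (H2).
-/

-- single-problem summit: the doubled namespace component `ResolutionOfSingularities` is forced
set_option linter.dupNamespace false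

noncomputable section

namespace Summit.ResolutionOfSingularities.ResolutionOfSingularities.Theorems.WildQuotientResolution.InvolutionExit

open Literature.AlgebraicGeometry.Resolution (augIdeal sub_mem_augIdeal)
open scoped Pointwise

variable {R : Type*} [CommRing R] (ι : R ≃+* R) (hι : ∀ x, ι (ι x) = x)

/-- `r − ι r ∈ I_ι` for every `r`. [folklore] -/
theorem self_sub_apply_mem_augIdeal (r : R) : r - ι r ∈ augIdeal ι := by
  have h : r - ι r = -(ι r - r) := by ring
  rw [h]
  exact neg_mem (sub_mem_augIdeal ι r)

include hι in
/-- **`K = I_ι²`**: the ideal generated by the products of two anti-invariant elements is the square of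
the augmentation ideal (`2` invertible). [OURS · L1 W4.5c, card `mu2-strata-kl-twice` H3] [folklore] -/
theorem span_anti_mul_anti_eq_sq (h2 : IsUnit (2 : R)) :
    Ideal.span {z : R | ∃ a b : R, ι a = -a ∧ ι b = -b ∧ z = a * b} = augIdeal ι ^ 2 := by
  have hset : {z : R | ∃ a b : R, ι a = -a ∧ ι b = -b ∧ z = a * b} =
      {y : R | ι y = -y} * {y : R | ι y = -y} := by
    ext z
    simp only [Set.mem_setOf_eq, Set.mem_mul]
    constructor
    · rintro ⟨a, b, ha, hb, rfl⟩
      exact ⟨a, ha, b, hb, rfl⟩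
    · rintro ⟨a, ha, b, hb, rfl⟩
      exact ⟨a, b, ha, hb, rfl⟩
  rw [hset, ← Ideal.span_mul_span', ← augIdeal_eq_span_anti ι hι h2, pow_two]

include hι in
/-- **The parity engine.** For `z ∈ I_ι ^ n`: `z + ι z ∈ I_ι ^ (2⌈n/2⌉)` and
`z − ι z ∈ I_ι ^ (2⌊n/2⌋ + 1)` (`2` invertible). [OURS · L1 W4.5c, card `mu2-strata-kl-twice` H3]
[folklore] -/
theorem add_apply_mem_pow_and_sub_apply_mem_pow (h2 : IsUnit (2 : R)) {n : ℕ} {z : R}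
    (hz : z ∈ augIdeal ι ^ n) :
    z + ι z ∈ augIdeal ι ^ (2 * ((n + 1) / 2)) ∧ z - ι z ∈ augIdeal ι ^ (2 * (n / 2) + 1) := by
  obtain ⟨u, hu⟩ := h2.exists_left_inv
  set I := augIdeal ι with hI
  induction hz using Submodule.pow_induction_on_right' with
  | algebraMap r =>
    refine ⟨?_, ?_⟩
    · simp
    · simpa using self_sub_apply_mem_augIdeal ι ((algebraMap R R) r)
  | add x y i hx hy ihx ihy =>
    refine ⟨?_, ?_⟩
    · have e : x + y + ι (x + y) = (x + ι x) + (y + ι y) := by rw [map_add]; ring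
      rw [e]; exact add_mem ihx.1 ihy.1
    · have e : x + y - ι (x + y) = (x - ι x) + (y - ι y) := by rw [map_add]; ring
      rw [e]; exact add_mem ihx.2 ihy.2
  | mul_mem i x hx ihx m hm =>
    have hmI : m ∈ augIdeal ι := hm
    have hmp : m + ι m ∈ augIdeal ι ^ 2 := by
      rw [add_comm]; exact apply_add_self_mem_sq ι hι h2 hmI
    have hmm : m - ι m ∈ augIdeal ι ^ 1 := by
      rw [pow_one]; exact self_sub_apply_mem_augIdeal ι m
    obtain ⟨hxp, hxm⟩ := ihx
    refine ⟨?_, ?_⟩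
    · have e : x * m + ι (x * m) =
          u * ((x + ι x) * (m + ι m) + (x - ι x) * (m - ι m)) := by
        rw [map_mul]
        have h2x : x * m + ι x * ι m = u * (2 * (x * m + ι x * ι m)) := by
          rw [← mul_assoc, hu, one_mul]
        rw [h2x]; ring
      rw [e]
      refine Ideal.mul_mem_left _ _ (add_mem ?_ ?_)
      · have h := Ideal.mul_mem_mul hxp hmp
        rw [← pow_add] at h
        exact Ideal.pow_le_pow_right (by omega) h
      · have h := Ideal.mul_mem_mul hxm hmm
        rw [← pow_add] at h
        exact Ideal.pow_le_pow_right (by omega) h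
    · have e : x * m - ι (x * m) =
          u * ((x + ι x) * (m - ι m) + (x - ι x) * (m + ι m)) := by
        rw [map_mul]
        have h2x : x * m - ι x * ι m = u * (2 * (x * m - ι x * ι m)) := by
          rw [← mul_assoc, hu, one_mul]
        rw [h2x]; ring
      rw [e]
      refine Ideal.mul_mem_left _ _ (add_mem ?_ ?_)
      · have h := Ideal.mul_mem_mul hxp hmm
        rw [← pow_add] at h
        exact Ideal.pow_le_pow_right (by omega) h
      · have h := Ideal.mul_mem_mul hxm hmp
        rw [← pow_add] at h
        exact Ideal.pow_le_pow_right (by omega) h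

include hι in
/-- **Invariants of odd weight move up.** For an `ι`-INVARIANT `x` (`2` invertible):
`x ∈ I_ι ^ n ↔ x ∈ I_ι ^ (2⌈n/2⌉)`. [OURS · L1 W4.5c, card `mu2-strata-kl-twice` H3] [folklore] -/
theorem mem_pow_iff_mem_pow_two_mul_of_invariant (h2 : IsUnit (2 : R)) (n : ℕ) (x : R)
    (hx : ι x = x) : x ∈ augIdeal ι ^ n ↔ x ∈ augIdeal ι ^ (2 * ((n + 1) / 2)) := by
  constructor
  · intro h
    have h1 := (add_apply_mem_pow_and_sub_apply_mem_pow ι hι h2 h).1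
    rw [hx] at h1
    obtain ⟨u, hu⟩ := h2.exists_left_inv
    have e : x = u * (x + x) := by rw [← two_mul, ← mul_assoc, hu, one_mul]
    rw [e]
    exact Ideal.mul_mem_left _ _ h1
  · intro h
    exact Ideal.pow_le_pow_right (by omega) h

include hι in
/-- **H3 (Rees parity lemma), the Sketch statement verbatim.** With
`K = (a·b : ι a = −a, ι b = −b)`, an INVARIANT `x` lies in `I_ι ^ n` iff it lies in
`K ^ ⌈n/2⌉` (`2` invertible). [OURS · L1 W4.5c, card `mu2-strata-kl-twice` H3] [folklore] -/
theorem mem_augIdeal_pow_iff_mem_span_pow_of_invariant (h2 : IsUnit (2 : R)) (n : ℕ) (x : R)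
    (hx : ι x = x) :
    x ∈ augIdeal ι ^ n ↔
      x ∈ Ideal.span {z : R | ∃ a b : R, ι a = -a ∧ ι b = -b ∧ z = a * b} ^ ((n + 1) / 2) := by
  rw [span_anti_mul_anti_eq_sq ι hι h2, ← pow_mul, mem_pow_iff_mem_pow_two_mul_of_invariant ι hι h2 n x hx]

end Summit.ResolutionOfSingularities.ResolutionOfSingularities.Theorems.WildQuotientResolution.InvolutionExit

end
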